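import Summits.AtomisticToContinuum.Crystallization.Theorems.ChartedZeroExcessLayeredLatticeLiouvilleZZZF
import Summits.AtomisticToContinuum.Crystallization.Theorems.ChartedZeroExcessLayeredLatticeLiouvilleZZZ
import Summits.AtomisticToContinuum.Crystallization.Theorems.ChartedZeroExcessLayeredLatticeLiouvilleZZV
import Summits.AtomisticToContinuum.Crystallization.Theorems.ChartedZeroExcessLayeredLatticeLiouvilleZZW
import Summits.AtomisticToContinuum.Crystallization.Theorems.ChartedZeroExcessLayeredLatticeLiouvilleZMA

/-!
# (B′.7a) ZZZG — THE PLACED-CRYSTAL CHART PIECE (CC) TYPED, AND (GL₂) ⟸ (CC) AT THE RECORD DIALS (1 def, 4 theorems)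

Lineage `stmt-AtomisticToContinuum-26636` (route ChartedPlanarOrder), lens-2 g82 «structural dichotomy (special vs generic)».  Critic row 1519
lists, after the W1-β landings ZZZA–ZZZF, the open items of the lineage: **(CC) = LEMMA C's chart data** (`hΦ / hsepC / hgapC / hlc / hout` + the
C-side of rider R2-C) and the ₂-pieces (AR₂)/(LN₂)/(CV₂)/(GC₂).  This file TYPES (CC) as ONE Prop on the SPECIAL class alone and proves that it is
ALL that (GL₂) still wants.

* `PlacedCrystalChartP σ ϑr Rs` — **the special class is globally Barlow-bond-charted**: for every CLEAN configuration `H` (every atom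
  `(1/16, 9/10, 1)`-two-shell-good) and every layered crystal `H₀ = LayeredHom L' w'` that is `σ`-separated and whose every `Rs`-environment is
  two-sidedly `ϑr`-shadowed (by translation, `EnvClose`) by an environment of `H` — clauses (ii)/(iii) of `IsCoolShadowCrystal` — every placed copy
  `placedCrystal L' w' U t` carries a GLOBAL Barlow bond chart (`IsBarlowBondChart … Set.univ Φ τC`) that is ONTO.  Purely kinematic: no `S`, no
  container, no energy, no label.  Why it might fail: a shadow of a clean crystal is only `(1/16 + O(ϑr))`-good with scales down to `9/10 − ϑr`,
  outside the hard-coded dials `(1/16, 9/10, 103/100)` of lens-3's `barlowGluingW_holds`; and a global chart needs the window graph of `H₀` connected.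
  Sources: lens-3 `ChartedPlanarOrderBarlowGluing{Frame,Charts,}` (chart bundle ⇒ `IsCharted`), `CleanHull.transfer_of_close` (tolerance `b/5`),
  YZ `IsCoolShadowCrystal`, ZMA `placedCrystal_gap`; [HalesDSP2012, §1.3].
* ★★ `bondLabelP₂_of_placedCrystalChartP` — **(GL₂) at the record dials ⟸ (CC) at `(σ, ϑr, Rs) = (17/20, 10⁻⁴, 5)`, for EVERY `ϑc`**: under (GL₂)'s
  binders the S-side binders of `exists_isBondLabel₂_of_package` (ZZZF) are tree facts — global S-chart `exists_globalChart_of_isCharted` (ZJ),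
  cleanliness `isTwoShellGoodSet_of_isDoorSetP` (ZCA), separation `27/32` (`isSep_of_isDoorSetP`, YZA), bond gap `17/16` (`isBond_iff_of_isDoorSetP`, ZC),
  C-separation `17/20` (`isSep_placedCrystal`, YZA), C-gap `17/16 + 2·10⁻⁴` (`placedCrystal_gap`, ZMA), finiteness of the charted sites near `K`
  (injective charts of separated sets, `K ⊆ B̄(x₀, 4)`), the riders R1 `windowConnected` (ZZZ), R2-S `layerCovered` (ZZV), R2-C `readCovered` (ZZW; its
  REG-in input is clause (v) of the cool shadow crystal at `(rI, ℓ) = (10, 43/2)`), and `hout` = clause (iv) (REG-out on the moat `(8, 43/2)`) read through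
  the ONTO chart; with the chart domain `D = univ` both link-closure binders are trivial.  The corner `K = ∅` is served by `lab := id` (every clause of
  `IsBondLabel` quantifies over atoms near `K`).

STATUS: (CC) is PROVED at the record dials in the sequel ZZZK (`placedCrystalChartP_record`), whence `bondLabelP₂_record : ∀ ϑc, BondLabelP₂ ϑc …`
— (GL₂) leaves critic row 1519's open list.

0 sorry; no new real-side estimate (composition only); no instance, no notation.
-/

noncomputable section
open scoped RealInnerProductSpace
open Set Metric
open Literature.Geometry.DiscreteGeometry (IsTwoShellGoodSet)
open Literature.Probability.Process.LocalConfig (finite_inter_of_separated)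

namespace Summit.AtomisticToContinuum.Crystallization.Theorems.ChartedZeroExcessLayeredLatticeLiouville

open Summit.AtomisticToContinuum.Crystallization.Theorems.ChartedPlanarOrderRigidityDoor (E3 IsClean)
open Summit.AtomisticToContinuum.Crystallization.Theorems.ChartedPlanarOrderDensityDichotomy (μS IsSep)
open Summit.AtomisticToContinuum.Crystallization.Theorems.ChartedPlanarOrderCleanScaleP (IsDoorSetP)
open Summit.AtomisticToContinuum.Crystallization.Theorems.ChartedPlanarOrderMesoCut (LayeredHom EnvClose)

/-! ### ZZZG-1  The piece (CC) -/

/-- ★ **(CC) `PlacedCrystalChartP σ ϑr Rs` — THE SPECIAL CLASS IS GLOBALLY BARLOW-BOND-CHARTED.**  For every clean `H` and every `σ`-separated layered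
crystal `LayeredHom L' w'` all of whose `Rs`-environments are two-sidedly `ϑr`-shadowed by environments of `H`, every placed copy
`placedCrystal L' w' U t` has a global (`D = univ`), onto Barlow bond chart.  Kinematic.  PROVED at the record dials `(17/20, 10⁻⁴, 5)` by the
sequel ZZZK (`placedCrystalChartP_record`: shadow transfer ZZZH + the ported gluing ZZZI/ZZZJ); why it might have failed / sources: module docstring. -/
def PlacedCrystalChartP (σ ϑr Rs : ℝ) : Prop :=
  ∀ H : Set E3, IsClean (μS H) →
    ∀ (L' : E3 →L[ℝ] E3) (w' : ℤ → E3) (U : E3 ≃ₗᵢ[ℝ] E3) (t : E3), IsSep σ (LayeredHom L' w') →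
      (∀ x' ∈ LayeredHom L' w', ∃ x ∈ H, EnvClose ϑr Rs (LayeredHom L' w') x' H x) →
        ∃ (Φ : ℤ × ℤ × ℤ → E3) (τC : ℤ → Bool),
          IsBarlowBondChart (placedCrystal L' w' U t) Set.univ Φ τC ∧ ∀ c ∈ placedCrystal L' w' U t, ∃ y, Φ y = c

/-! ### ZZZG-2  Finiteness of the charted sites near a bounded container -/

/-- the sites of an injective chart of a `σ`-separated set (`σ > 0`) that land in the region `D'` within `R` of a container `K ⊆ B̄(x₀, q)` are
finitely many. [formal bookkeeping] -/
theorem finite_chartSites_near {σ q R : ℝ} {C K : Set E3} {D : Set (ℤ × ℤ × ℤ)} {Φ : ℤ × ℤ × ℤ → E3} {τ : ℤ → Bool} {x₀ : E3}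
    (hσ : 0 < σ) (hsep : IsSep σ C) (hΦ : IsBarlowBondChart C D Φ τ) (hK : ∀ k ∈ K, dist k x₀ ≤ q) :
    Set.Finite {y : ℤ × ℤ × ℤ | y ∈ D ∧ ∃ k ∈ K, dist (Φ y) k ≤ R} := by
  have hF : (closedBall x₀ (R + q) ∩ C).Finite := finite_inter_of_separated hσ hsep (isCompact_closedBall x₀ (R + q))
  refine Set.Finite.of_finite_image (hF.subset ?_) (hΦ.1.mono fun y hy => hy.1)
  rintro _ ⟨y, ⟨hyD, k, hk, hyk⟩, rfl⟩
  exact ⟨mem_closedBall.2 (by linarith [dist_triangle (Φ y) k x₀, hK k hk]), hΦ.2.1 hyD⟩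

/-- the `D = univ` form of `finite_chartSites_near`. [formal bookkeeping] -/
theorem finite_chartSites_near_univ {σ q R : ℝ} {C K : Set E3} {Φ : ℤ × ℤ × ℤ → E3} {τ : ℤ → Bool} {x₀ : E3}
    (hσ : 0 < σ) (hsep : IsSep σ C) (hΦ : IsBarlowBondChart C Set.univ Φ τ) (hK : ∀ k ∈ K, dist k x₀ ≤ q) :
    Set.Finite {y : ℤ × ℤ × ℤ | ∃ k ∈ K, dist (Φ y) k ≤ R} :=
  (finite_chartSites_near (R := R) hσ hsep hΦ hK).subset fun y hy => ⟨mem_univ y, hy⟩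

/-! ### ZZZG-3  ★★ (GL₂) ⟸ (CC) at the record dials -/

/-- the corner `K = ∅` of a bond label: `lab := id`. [formal bookkeeping] -/
theorem isBondLabel_empty (ε r ℓ : ℝ) (S C : Set E3) : IsBondLabel ε r ℓ S (∅ : Set E3) C id :=
  ⟨fun _ _ ⟨_, hk, _⟩ => (Set.notMem_empty _ hk).elim, fun _ _ _ _ ⟨_, hk, _⟩ => (Set.notMem_empty _ hk).elim,
    fun _ ⟨_, _, hk, _⟩ => (Set.notMem_empty _ hk).elim, fun _ _ ⟨_, hk, _⟩ => (Set.notMem_empty _ hk).elim⟩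

/-- ★★ **(GL₂) AT THE RECORD DIALS FROM (CC) AT `(17/20, 10⁻⁴, 5)`, for every `ϑc`** (see the module docstring for the twelve tree facts composed).
[this file, g82] -/
theorem bondLabelP₂_of_placedCrystalChartP (hCC : PlacedCrystalChartP (17 / 20) (1 / 10000) 5) (ϑc : ℝ) :
    BondLabelP₂ ϑc (1 / 10) 8 (145 / 16) 4 12 16 (17 / 20) (1 / 10000) 5 (1 / 10000) 10 (43 / 2) 1 2 (1 / 16) (1 / 50) := by
  intro δ hδ a ha S hS hsum hgood L w hL x₀ K hKS hKq hTp hTc L' w' U t hcr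
  -- the corner `K = ∅`
  rcases K.eq_empty_or_nonempty with rfl | hKne
  · exact ⟨id, isBondLabel_empty _ _ _ _ _⟩
  -- the C-chart from (CC): clean chart crystal `hL.2.2.2.1`, separation (ii) and shadow (iii) of the cool shadow crystal
  obtain ⟨Φ, τC, hΦ, hsurjΦ⟩ := hCC _ hL.2.2.2.1 L' w' U t hcr.2.1 hcr.2.2.1
  -- the S-chart and the S-side facts of a door set
  obtain ⟨Ψ, τS, hΨ, hsurjΨ⟩ := exists_globalChart_of_isCharted hS.2.2.2.2
  have hclean : ∀ p ∈ S, IsTwoShellGoodSet (1 / 16) (9 / 10) 1 S p := fun p hp => isTwoShellGoodSet_of_isDoorSetP hS hp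
  have hsepS : IsSep (27 / 32) S := isSep_of_isDoorSetP le_rfl hS
  have hgapS : ∀ p ∈ S, ∀ p' ∈ S, IsBond p p' → dist p p' ≤ 17 / 16 := fun p hp p' hp' hb => by
    have h := ((isBond_iff_of_isDoorSetP le_rfl hS hp hp').1 hb).2
    linarith
  -- the C-side facts of a cool shadow crystal
  have hsepC : IsSep (17 / 20) (placedCrystal L' w' U t) := isSep_placedCrystal U t hcr.2.1
  have hgapC : ∀ c ∈ placedCrystal L' w' U t, ∀ c' ∈ placedCrystal L' w' U t, IsBond c c' →
      dist c c' ≤ 17 / 16 + 2 * (1 / 10000) := fun c hc c' hc' hb =>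
    placedCrystal_gap hL.2.2.2.1 hcr (by norm_num) (by norm_num) hc hc' hb.2
  -- the container is finite; the charted sites near it are finitely many on both sides
  have hKfin : K.Finite :=
    (finite_inter_of_separated hδ hS.2.1 (isCompact_closedBall x₀ 4)).subset fun k hk => ⟨mem_closedBall.2 (hKq k hk), hKS hk⟩
  have hfin : Set.Finite {x : ℤ × ℤ × ℤ | ∃ k ∈ K, dist (Ψ x) k ≤ 43 / 2} :=
    finite_chartSites_near_univ (by norm_num) hsepS hΨ hKq
  have hfinC : Set.Finite {y : ℤ × ℤ × ℤ | y ∈ (Set.univ : Set (ℤ × ℤ × ℤ)) ∧ ∃ k ∈ K, dist (Φ y) k ≤ 43 / 2} :=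
    finite_chartSites_near (by norm_num) hsepC hΦ hKq
  -- link closure is free on `D = univ`
  have hlc43 : ∀ y ∈ (Set.univ : Set (ℤ × ℤ × ℤ)), (∃ k ∈ K, dist (Φ y) k < 43 / 2) → ∀ y' : ℤ × ℤ × ℤ,
      BarlowAdj τC y y' → y' ∈ (Set.univ : Set (ℤ × ℤ × ℤ)) := fun _ _ _ y' _ => mem_univ y'
  have hlc : ∀ y ∈ (Set.univ : Set (ℤ × ℤ × ℤ)), (∃ k ∈ K, dist (Φ y) k < 21 / 2) → ∀ y' : ℤ × ℤ × ℤ,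
      BarlowAdj τC y y' → y' ∈ (Set.univ : Set (ℤ × ℤ × ℤ)) := fun _ _ _ y' _ => mem_univ y'
  -- REG-out partners are charted sites (the chart is onto)
  have hout : ∀ p ∈ moatIn S K 8 (43 / 2), ∃ y ∈ (Set.univ : Set (ℤ × ℤ × ℤ)), dist p (Φ y) ≤ 1 / 10000 := fun p hp => by
    obtain ⟨c, hc, hpc⟩ := hcr.2.2.2.1 p hp.1 hp.2.1 hp.2.2
    obtain ⟨y, rfl⟩ := hsurjΦ c hc
    exact ⟨y, mem_univ y, hpc⟩
  -- the three riders
  have hR1 : WindowConnected S K Ψ τS := windowConnected hΨ hsurjΨ hclean hKfin hKne hKq hfin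
  have hR2S : LayerCovered S K Ψ := layerCovered hΨ hKne hfin
  have hR2C : ReadCovered S K Set.univ Ψ Φ (1 / 10000) := readCovered hΦ hlc43 hcr.2.2.2.2 hsurjΨ hKne hfinC (by norm_num)
  exact exists_isBondLabel₂_of_package le_rfl hS hcr hΨ hsurjΨ hclean hsepS (by norm_num) hgapS (by norm_num) le_rfl hΦ hsepC
    (by norm_num) hgapC (by norm_num) hlc hKS hKfin hKne hKq hout hfin hR1 hR2S hR2C

end Summit.AtomisticToContinuum.Crystallization.Theorems.ChartedZeroExcessLayeredLatticeLiouville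

end
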